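import Summits.ResolutionOfSingularities.ResolutionOfSingularities.Theorems.FrobeniusLadderFInjectiveMacaulayficationCNStrongPlusStepRel
import Summits.ResolutionOfSingularities.ResolutionOfSingularities.Theorems.FrobeniusLadderFInjectiveMacaulayficationCNCylinderPrelims
import HarnessLib

/-!
# CN DATA × 𝔸¹: an absolute Cartier–Newton datum for `f ∈ k[X_n]` yields a STRONG⁺ confined iso-step for the CYLINDER
# `Spec k[X_{n+1}]/(f)` at the generic point of its axis `V(x̄₁,…,x̄_n)` (crux `FInjectiveMacaulayfication`
# stmt-ResolutionOfSingularities-15315, chain w45a, hole #3; CRUX-PLAN v8 §5 «stub-5 → (iv) Q6-LINE», generic form)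

Support file for crux stmt-ResolutionOfSingularities-15315 (`FrobeniusLadder.FInjectiveMacaulayfication`), chain w45a, seat
res-D-pv-017 AS res-L1-w45a-stub-5. [OURS · L1 W4.5a] — NOT a statement of any manuscript; AI-written, weaker than expert review.

INPUT: the ABSOLUTE data of the CN engine G5ᴾ for `f ∈ k[X_{Fin n}]` — exactly the binders of
`CNConeFiModelPrime.cnConeFiModel_of_isPrime` (p496198) EXCEPT the clause off the origin: the `𝔪`-primary monomial centre `A`
(`0 ∉ A`, pure powers of every variable), unimodular vertex charts `V_c` with vertices `m_c`, neighbours `a_c i`, (hgen)/(h≥), the cover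
identities, `(f)` prime with all `x̄ⱼ ≠ 0`, Cartier–Newton faces in Fedder form for the strictly positive row-subset weights, the strict
transforms `θ_c f = y^(dv c) g_c` with no `yᵢ ∣ g_c` and simultaneous minimisers. PLUS, for the cylinder `R′ = k[X_{Fin (n+1)}]/(f′)`,
`f′ = rename Fin.succ f` (new variable `X 0`): the clause at the maximal ideals of `R′` OFF THE AXIS `V(x̄₁,…,x̄_n)` (hypothesis `hoff′`;
for a hypersurface with an isolated singularity it is regularity off the axis), and a point `η` of `Spec R′` with `η.asIdeal = (x̄₁,…,x̄_n)`.

OUTPUT (`strongPlusStep_cylinder_of_cnData`): the ∃-clause of the hole-#3 stub `stub_confinedIsoStepStrongPlus` VERBATIM for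
`X₁ = Spec R′` at `η` — a STRONG⁺ step at a NON-CLOSED point (the generic point of the axis, a curve of bad points), empty residual.
Proof: the relative data for `J = {succ i}` — `A′ = A∘succ⁻¹ ∪ {m_c∘succ⁻¹ + e₀}`, `V′_c = 1 ⊕ V_c`, `m′, a′, dv′` shifted, `g′ = rename g` —
satisfy the hypotheses of `CNStrongPlusStepRel.strongPlusStep_of_cnData` (p499436) by the bookkeeping of `…CNCylinderPrelims`
(block `mulVec`/determinant/column monomials/weights, `rename` vs weighted components, primality, `x̄ᵥ ≠ 0`, `Xᵢ ∤ g′`, Fedder transfer).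
First consumer: Q6-LINE `V(f₂) × 𝔸¹ ⊂ 𝔸⁴` over `𝔽₅` (stub-3's Q6 data module + the Q6 Jacobian cofactors). No definitions, no named facts.
[folklore]
-/

-- single-problem summit: the doubled namespace component is forced
set_option linter.dupNamespace false

noncomputable section

open AlgebraicGeometry CategoryTheory Literature.AlgebraicGeometry.Resolution MvPolynomial

namespace Summit.ResolutionOfSingularities.ResolutionOfSingularities.Theorems.FInjectiveMacaulayfication.CNCylinder

open Summit.ResolutionOfSingularities.ResolutionOfSingularities.Theorems.FInjectiveMacaulayfication

/-! ## §1 Two more bookkeeping facts -/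

/-- Shifting exponents is monotone. [folklore] -/
theorem mapDomain_succ_le {n : ℕ} {x y : Fin n →₀ ℕ} (h : x ≤ y) : x.mapDomain Fin.succ ≤ y.mapDomain Fin.succ := by
  intro j
  refine Fin.cases ?_ (fun j => ?_) j
  · rw [mapDomain_succ_apply_zero, mapDomain_succ_apply_zero]
  · rw [mapDomain_succ_apply_succ, mapDomain_succ_apply_succ]
    exact h j

/-- `rename succ` maps the monomial ideal of `A` into the monomial ideal of any exponent set containing the shifts of `A`. [folklore] -/
theorem map_rename_span_monomial_le {k : Type} [Field k] {n : ℕ} (A : Finset (Fin n →₀ ℕ)) (A' : Finset (Fin (n + 1) →₀ ℕ))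
    (hAA' : ∀ x ∈ A, x.mapDomain Fin.succ ∈ A') :
    (Ideal.span ((fun b : Fin n →₀ ℕ => (MvPolynomial.monomial b (1 : k) : MvPolynomial (Fin n) k)) '' (A : Set (Fin n →₀ ℕ)))).map
        (rename Fin.succ : MvPolynomial (Fin n) k →ₐ[k] MvPolynomial (Fin (n + 1)) k).toRingHom ≤
      Ideal.span ((fun b : Fin (n + 1) →₀ ℕ => (MvPolynomial.monomial b (1 : k) : MvPolynomial (Fin (n + 1)) k)) '' (A' : Set (Fin (n + 1) →₀ ℕ))) := by
  rw [Ideal.map_span]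
  refine Ideal.span_mono ?_
  rintro _ ⟨_, ⟨b, hb, rfl⟩, rfl⟩
  refine ⟨b.mapDomain Fin.succ, hAA' b hb, ?_⟩
  simp only [AlgHom.toRingHom_eq_coe, RingHom.coe_coe, rename_monomial]

/-! ## §2 The cylinder step -/

set_option maxHeartbeats 1600000 in
/-- **CN DATA × 𝔸¹ ⇒ A STRONG⁺ STEP AT THE GENERIC POINT OF THE AXIS** (module docstring). [folklore] -/
theorem strongPlusStep_cylinder_of_cnData (p : ℕ) [Fact p.Prime] (k : Type) [Field k] [CharP k p] (n : ℕ) (hn : 0 < n)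
    (A : Finset (Fin n →₀ ℕ)) (hA0 : (0 : Fin n →₀ ℕ) ∉ A)
    (hprim : ∀ j : Fin n, ∃ e : ℕ, 0 < e ∧ Finsupp.single j e ∈ A)
    (t : ℕ) (ht : 0 < t) (V : Fin t → Matrix (Fin n) (Fin n) ℕ) (hV : ∀ c, IsUnit ((V c).map (Nat.cast : ℕ → ℤ)).det)
    (m : Fin t → (Fin n →₀ ℕ)) (hm : ∀ c, m c ∈ A) (a : Fin t → Fin n → (Fin n →₀ ℕ)) (haA : ∀ c i, a c i ∈ A)
    (hgen : ∀ (c : Fin t) (i : Fin n), (Finsupp.equivFunOnFinite.symm ((V c).mulVec ⇑(a c i)) : Fin n →₀ ℕ) =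
      Finsupp.equivFunOnFinite.symm ((V c).mulVec ⇑(m c)) + Finsupp.single i 1)
    (hge : ∀ (c : Fin t), ∀ e ∈ A, (Finsupp.equivFunOnFinite.symm ((V c).mulVec ⇑(m c)) : Fin n →₀ ℕ) ≤
      Finsupp.equivFunOnFinite.symm ((V c).mulVec ⇑e))
    (hcov : ∀ e ∈ A, ∃ (c : Fin t) (K : ℕ), 1 ≤ K ∧ ∃ y ∈ (Ideal.span ((fun b : Fin n →₀ ℕ => (MvPolynomial.monomial b (1 : k) : MvPolynomial (Fin n) k)) '' (A : Set (Fin n →₀ ℕ)))) ^ (K - 1),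
      (MvPolynomial.monomial e (1 : k) : MvPolynomial (Fin n) k) ^ K = MvPolynomial.monomial (m c) 1 * y)
    (f : MvPolynomial (Fin n) k) (hfprime : (Ideal.span {f}).IsPrime)
    (hXne : ∀ v : Fin n, Ideal.Quotient.mk (Ideal.span {f}) (MvPolynomial.X v) ≠ 0)
    (hCN : ∀ (c : Fin t) (S : Finset (Fin n)), (∀ j : Fin n, 0 < ∑ i ∈ S, V c i j) →
      (∀ D : ℕ, (MvPolynomial.weightedHomogeneousComponent (fun j : Fin n => ∑ i ∈ S, V c i j) D f ≠ 0 ∧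
          ∀ D' < D, MvPolynomial.weightedHomogeneousComponent (fun j : Fin n => ∑ i ∈ S, V c i j) D' f = 0) →
        ∀ (K : Type) [Field K] [Algebra k K] (b : Fin n → K), (∀ i, b i ≠ 0) →
          MvPolynomial.aeval b (MvPolynomial.weightedHomogeneousComponent (fun j : Fin n => ∑ i ∈ S, V c i j) D f) = 0 →
          (MvPolynomial.map (algebraMap k K) (MvPolynomial.weightedHomogeneousComponent (fun j : Fin n => ∑ i ∈ S, V c i j) D f)) ^ (p - 1) ∉
            Ideal.span (Set.range fun i : Fin n => (MvPolynomial.X i - MvPolynomial.C (b i)) ^ p)))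
    (dv : Fin t → (Fin n →₀ ℕ)) (g : Fin t → MvPolynomial (Fin n) k)
    (hg : ∀ c, MvPolynomial.aeval (fun j : Fin n => ∏ i : Fin n, (MvPolynomial.X i : MvPolynomial (Fin n) k) ^ V c i j) f = MvPolynomial.monomial (dv c) 1 * g c)
    (hndiv : ∀ c, ∀ i : Fin n, ¬ (MvPolynomial.X i ∣ g c))
    (hface : ∀ c, ∃ m ∈ f.support, ∀ i : Fin n, ∑ j : Fin n, V c i j * m j = dv c i)
    (hoff' : ∀ (Q : Ideal (MvPolynomial (Fin (n + 1)) k ⧸ Ideal.span {rename Fin.succ f})) [Q.IsMaximal],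
      (∃ j : Fin n, Ideal.Quotient.mk (Ideal.span {rename Fin.succ f}) (MvPolynomial.X j.succ) ∉ Q) →
      ∀ d : ℕ, ringKrullDim (Localization.AtPrime Q) = d → ∀ s : Fin d → Localization.AtPrime Q,
        (Ideal.span (Set.range s)).radical.IsMaximal →
          RingTheory.Sequence.IsWeaklyRegular (Localization.AtPrime Q) (List.ofFn s) ∧
          ∀ y : Localization.AtPrime Q, (∃ e : ℕ, y ^ p ^ e ∈ Ideal.span
            ((fun z : Localization.AtPrime Q => z ^ p ^ e) ''
              (Ideal.span (Set.range s) : Set (Localization.AtPrime Q)))) → y ∈ Ideal.span (Set.range s))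
    (η : ↥(Spec (.of (MvPolynomial (Fin (n + 1)) k ⧸ Ideal.span {rename Fin.succ f}))))
    (hη : η.asIdeal = Ideal.span (Set.range fun j : Fin n => Ideal.Quotient.mk (Ideal.span {rename Fin.succ f}) (X j.succ))) :
    ∃ (X₂ : Scheme.{0}) (π : X₂ ⟶ Spec (.of (MvPolynomial (Fin (n + 1)) k ⧸ Ideal.span {rename Fin.succ f}))), IsProper π ∧
      Literature.AlgebraicGeometry.Resolution.IsBirational π ∧
      IsIntegral X₂ ∧ (∀ x : X₂, (∀ d : ℕ, ringKrullDim (X₂.presheaf.stalk x) = d → ∀ s : Fin d → X₂.presheaf.stalk x, (Ideal.span (Set.range s)).radical.IsMaximal → RingTheory.Sequence.IsWeaklyRegular (X₂.presheaf.stalk x) (List.ofFn s))) ∧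
      IsIso (π ∣_ ⟨(closure ({η} : Set ↥(Spec (.of (MvPolynomial (Fin (n + 1)) k ⧸ Ideal.span {rename Fin.succ f})))))ᶜ, isClosed_closure.isOpen_compl⟩) ∧
      ∀ x : X₂, π.base x ∈ closure ({η} : Set ↥(Spec (.of (MvPolynomial (Fin (n + 1)) k ⧸ Ideal.span {rename Fin.succ f})))) → ¬ IsClosed ({x} : Set X₂) → (IsDomain (X₂.presheaf.stalk x) ∧ ∀ d : ℕ, ringKrullDim (X₂.presheaf.stalk x) = d → ∀ s : Fin d → X₂.presheaf.stalk x, (Ideal.span (Set.range s)).radical.IsMaximal → RingTheory.Sequence.IsWeaklyRegular (X₂.presheaf.stalk x) (List.ofFn s) ∧ ∀ t : X₂.presheaf.stalk x, (∃ e : ℕ, t ^ p ^ e ∈ Ideal.span ((fun z : X₂.presheaf.stalk x => z ^ p ^ e) '' (Ideal.span (Set.range s) : Set (X₂.presheaf.stalk x)))) → t ∈ Ideal.span (Set.range s)) := by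
  classical
  have hp : 0 < p := (Fact.out : p.Prime).pos
  -- THE RELATIVE DATA
  -- the stratum `J = {succ i}`
  set J : Finset (Fin (n + 1)) := Finset.univ.image (Fin.succ : Fin n → Fin (n + 1)) with hJ
  have hmemJ : ∀ j : Fin (n + 1), j ∈ J ↔ ∃ i : Fin n, i.succ = j := fun j => by
    simp only [hJ, Finset.mem_image, Finset.mem_univ, true_and]
  have hsuccJ : ∀ i : Fin n, i.succ ∈ J := fun i => (hmemJ _).mpr ⟨i, rfl⟩
  -- the centre `A′ = A∘succ⁻¹ ∪ {m_c∘succ⁻¹ + e₀}`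
  set A' : Finset (Fin (n + 1) →₀ ℕ) := A.image (Finsupp.mapDomain Fin.succ) ∪
    Finset.univ.image (fun c : Fin t => (m c).mapDomain Fin.succ + Finsupp.single 0 1) with hA'
  have hmemA' : ∀ e : Fin (n + 1) →₀ ℕ, e ∈ A' ↔
      (∃ x ∈ A, x.mapDomain Fin.succ = e) ∨ ∃ c : Fin t, (m c).mapDomain Fin.succ + Finsupp.single 0 1 = e := fun e => by
    simp only [hA', Finset.mem_union, Finset.mem_image, Finset.mem_univ, true_and]
  have hAA' : ∀ x ∈ A, x.mapDomain Fin.succ ∈ A' := fun x hx => (hmemA' _).mpr (Or.inl ⟨x, hx, rfl⟩)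
  have hmA' : ∀ c : Fin t, (m c).mapDomain Fin.succ + Finsupp.single 0 1 ∈ A' := fun c => (hmemA' _).mpr (Or.inr ⟨c, rfl⟩)
  -- the charts `V′_c = 1 ⊕ V_c`
  set V' : Fin t → Matrix (Fin (n + 1)) (Fin (n + 1)) ℕ := fun c => Matrix.of fun i j =>
    Fin.cases (Fin.cases (1 : ℕ) (fun _ => 0) j) (fun i' => Fin.cases 0 (fun j' => V c i' j') j) i with hV'
  have hW00 : ∀ c, V' c 0 0 = 1 := fun c => rfl
  have hW0s : ∀ c (j : Fin n), V' c 0 j.succ = 0 := fun c j => rfl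
  have hWs0 : ∀ c (i : Fin n), V' c i.succ 0 = 0 := fun c i => rfl
  have hWss : ∀ c (i j : Fin n), V' c i.succ j.succ = V c i j := fun c i j => rfl
  -- vertices, neighbours, strict transforms
  set m' : Fin t → (Fin (n + 1) →₀ ℕ) := fun c => (m c).mapDomain Fin.succ with hm'
  set a' : Fin t → Fin (n + 1) → (Fin (n + 1) →₀ ℕ) := fun c i =>
    Fin.cases ((m c).mapDomain Fin.succ + Finsupp.single 0 1) (fun i' => (a c i').mapDomain Fin.succ) i with ha'
  set dv' : Fin t → (Fin (n + 1) →₀ ℕ) := fun c => (dv c).mapDomain Fin.succ with hdv'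
  set g' : Fin t → MvPolynomial (Fin (n + 1)) k := fun c => rename Fin.succ (g c) with hg'
  -- THE HYPOTHESES OF THE RELATIVE ENGINE
  refine CNStrongPlusStepRel.strongPlusStep_of_cnData p k (n + 1) J ⟨_, hsuccJ ⟨0, hn⟩⟩ A' ?_ ?_ t ht V' ?_ m' ?_ a' ?_ ?_ ?_ ?_
    (rename Fin.succ f) (isPrime_span_rename_succ f hfprime) (mk_X_rename_succ_ne_zero f hfprime hXne) ?_ ?_ dv' g' ?_ ?_ ?_ η ?_
  · -- hAJ : every generator involves a `J`-variable
    intro e he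
    rcases (hmemA' e).mp he with ⟨x, hx, rfl⟩ | ⟨c, rfl⟩
    · have hx0 : x ≠ 0 := fun h => hA0 (h ▸ hx)
      obtain ⟨i, hi⟩ := exists_succ_pos_of_ne_zero hx0
      exact ⟨i.succ, hsuccJ i, hi⟩
    · have hx0 : m c ≠ 0 := fun h => hA0 (h ▸ hm c)
      obtain ⟨i, hi⟩ := exists_succ_pos_of_ne_zero hx0
      refine ⟨i.succ, hsuccJ i, ?_⟩
      rw [Finsupp.add_apply]
      exact Nat.lt_of_lt_of_le hi (Nat.le_add_right _ _)
  · -- hprim on `J`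
    intro j hj
    obtain ⟨i, rfl⟩ := (hmemJ j).mp hj
    obtain ⟨e, he, heA⟩ := hprim i
    refine ⟨e, he, ?_⟩
    rw [← Finsupp.mapDomain_single (f := Fin.succ)]
    exact hAA' _ heA
  · -- unimodularity of `1 ⊕ V_c`
    intro c
    exact isUnit_det_block (V c) (V' c) (hW00 c) (hW0s c) (hWss c) (hV c)
  · -- the vertices are generators
    intro c
    exact hAA' _ (hm c)
  · -- the neighbours are generators
    intro c i
    refine Fin.cases ?_ (fun i' => ?_) i
    · exact hmA' c
    · exact hAA' _ (haA c i')
  · -- (hgen) `V′ a′_i = V′ m′ + e_i`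
    intro c i
    refine Fin.cases ?_ (fun i' => ?_) i
    · show (Finsupp.equivFunOnFinite.symm ((V' c).mulVec ⇑((m c).mapDomain Fin.succ + Finsupp.single 0 1 : Fin (n + 1) →₀ ℕ)) : Fin (n + 1) →₀ ℕ) =
        Finsupp.equivFunOnFinite.symm ((V' c).mulVec ⇑((m c).mapDomain Fin.succ)) + Finsupp.single 0 1
      rw [mulVec_block (V c) (V' c) (hW00 c) (hW0s c) (hWs0 c) (hWss c),
        mulVec_block_zero (V c) (V' c) (hW00 c) (hW0s c) (hWs0 c) (hWss c)]
    · show (Finsupp.equivFunOnFinite.symm ((V' c).mulVec ⇑((a c i').mapDomain Fin.succ)) : Fin (n + 1) →₀ ℕ) =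
        Finsupp.equivFunOnFinite.symm ((V' c).mulVec ⇑((m c).mapDomain Fin.succ)) + Finsupp.single i'.succ 1
      rw [mulVec_block_zero (V c) (V' c) (hW00 c) (hW0s c) (hWs0 c) (hWss c),
        mulVec_block_zero (V c) (V' c) (hW00 c) (hW0s c) (hWs0 c) (hWss c), hgen c i', Finsupp.mapDomain_add,
        Finsupp.mapDomain_single]
  · -- (h≥) the vertex is minimal on `A′`
    intro c e he
    show (Finsupp.equivFunOnFinite.symm ((V' c).mulVec ⇑((m c).mapDomain Fin.succ)) : Fin (n + 1) →₀ ℕ) ≤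
      Finsupp.equivFunOnFinite.symm ((V' c).mulVec ⇑e)
    rw [mulVec_block_zero (V c) (V' c) (hW00 c) (hW0s c) (hWs0 c) (hWss c)]
    rcases (hmemA' e).mp he with ⟨x, hx, rfl⟩ | ⟨c', rfl⟩
    · rw [mulVec_block_zero (V c) (V' c) (hW00 c) (hW0s c) (hWs0 c) (hWss c)]
      exact mapDomain_succ_le (hge c x hx)
    · rw [mulVec_block (V c) (V' c) (hW00 c) (hW0s c) (hWs0 c) (hWss c)]
      exact (mapDomain_succ_le (hge c (m c') (hm c'))).trans le_self_add
  · -- the cover identities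
    intro e he
    rcases (hmemA' e).mp he with ⟨x, hx, rfl⟩ | ⟨c, rfl⟩
    · obtain ⟨c, K, hK, y, hy, hEq⟩ := hcov x hx
      refine ⟨c, K, hK, rename Fin.succ y, ?_, ?_⟩
      · have hy' := Ideal.mem_map_of_mem (rename Fin.succ : MvPolynomial (Fin n) k →ₐ[k] MvPolynomial (Fin (n + 1)) k).toRingHom hy
        rw [Ideal.map_pow] at hy'
        exact Ideal.pow_right_mono (map_rename_span_monomial_le A A' hAA') _ hy'
      · have h := congrArg (rename Fin.succ) hEq
        rw [map_pow, map_mul, rename_monomial, rename_monomial] at h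
        exact h
    · refine ⟨c, 1, le_rfl, X 0, by simp, ?_⟩
      show MvPolynomial.monomial ((m c).mapDomain Fin.succ + Finsupp.single 0 1) (1 : k) ^ 1 =
        MvPolynomial.monomial ((m c).mapDomain Fin.succ) 1 * X 0
      rw [pow_one, X, monomial_mul, mul_one]
  · -- hoff relative to `J`
    intro Q _ hQ
    obtain ⟨j, hj, hjQ⟩ := hQ
    obtain ⟨i, rfl⟩ := (hmemJ j).mp hj
    exact hoff' Q ⟨i, hjQ⟩
  · -- the Cartier–Newton faces positive on `J`
    intro c S hS D hD K _ _ b hb haev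
    -- the old rows meeting `S` and their weight
    set S₀ : Finset (Fin n) := Finset.univ.filter (fun i : Fin n => i.succ ∈ S) with hS₀
    have hw : (fun j : Fin (n + 1) => ∑ i ∈ S, V' c i j) ∘ Fin.succ = fun j : Fin n => ∑ i ∈ S₀, V c i j := by
      funext j
      exact weight_block_succ (V c) (V' c) (hW0s c) (hWss c) S j
    have hpos : ∀ j : Fin n, 0 < ∑ i ∈ S₀, V c i j := fun j => by
      rw [← weight_block_succ (V c) (V' c) (hW0s c) (hWss c) S j]
      exact hS j.succ (hsuccJ j)
    have hre : ∀ D : ℕ, weightedHomogeneousComponent (fun j : Fin (n + 1) => ∑ i ∈ S, V' c i j) D (rename Fin.succ f) =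
        rename Fin.succ (weightedHomogeneousComponent (fun j : Fin n => ∑ i ∈ S₀, V c i j) D f) := fun D => by
      rw [weightedHomogeneousComponent_rename_succ, hw]
    have hinj := rename_injective (R := k) (Fin.succ : Fin n → Fin (n + 1)) (Fin.succ_injective n)
    have hD₀ : weightedHomogeneousComponent (fun j : Fin n => ∑ i ∈ S₀, V c i j) D f ≠ 0 ∧
        ∀ D' < D, weightedHomogeneousComponent (fun j : Fin n => ∑ i ∈ S₀, V c i j) D' f = 0 := by
      refine ⟨fun h0 => hD.1 ?_, fun D' hD' => hinj ?_⟩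
      · rw [hre, h0, map_zero]
      · rw [← hre, hD.2 D' hD', map_zero]
    have haev₀ : aeval (b ∘ Fin.succ) (weightedHomogeneousComponent (fun j : Fin n => ∑ i ∈ S₀, V c i j) D f) = 0 := by
      rw [← aeval_rename, ← hre]
      exact haev
    have h := hCN c S₀ hpos D hD₀ K (b ∘ Fin.succ) (fun i => hb i.succ) haev₀
    rw [hre, map_rename]
    exact pow_not_mem_span_of_rename_succ p hp _ b h
  · -- the strict transforms `θ′_c f′ = y^(dv′ c) g′_c`
    intro c
    have hθ : (fun j : Fin (n + 1) => ∏ i : Fin (n + 1), (MvPolynomial.X i : MvPolynomial (Fin (n + 1)) k) ^ V' c i j) ∘ Fin.succ =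
        fun j : Fin n => rename Fin.succ (∏ i : Fin n, (MvPolynomial.X i : MvPolynomial (Fin n) k) ^ V c i j) := by
      funext j
      exact colMonomial_block_succ (V c) (V' c) (hW0s c) (hWss c) j
    have hcomp : aeval (fun j : Fin n => rename Fin.succ (∏ i : Fin n, (MvPolynomial.X i : MvPolynomial (Fin n) k) ^ V c i j)) f =
        rename Fin.succ (aeval (fun j : Fin n => ∏ i : Fin n, (MvPolynomial.X i : MvPolynomial (Fin n) k) ^ V c i j) f) := by
      have h := DFunLike.congr_fun
        (comp_aeval (f := fun j : Fin n => ∏ i : Fin n, (MvPolynomial.X i : MvPolynomial (Fin n) k) ^ V c i j)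
          (rename Fin.succ : MvPolynomial (Fin n) k →ₐ[k] MvPolynomial (Fin (n + 1)) k)) f
      rw [AlgHom.comp_apply] at h
      exact h.symm
    show aeval (fun j : Fin (n + 1) => ∏ i : Fin (n + 1), (MvPolynomial.X i : MvPolynomial (Fin (n + 1)) k) ^ V' c i j) (rename Fin.succ f) =
      MvPolynomial.monomial ((dv c).mapDomain Fin.succ) 1 * rename Fin.succ (g c)
    rw [aeval_rename, hθ, hcomp, hg c, map_mul, rename_monomial]
  · -- no variable divides `g′_c`
    intro c i
    exact X_not_dvd_rename_succ hn (g c) (hndiv c) i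
  · -- simultaneous minimisers
    intro c
    obtain ⟨m₀, hm₀, hmin⟩ := hface c
    refine ⟨m₀.mapDomain Fin.succ, ?_, fun i => ?_⟩
    · rw [support_rename_of_injective (Fin.succ_injective n)]
      exact Finset.mem_image_of_mem _ hm₀
    · have hv := congrArg (fun v : Fin (n + 1) →₀ ℕ => v i) (mulVec_block_zero (V c) (V' c) (hW00 c) (hW0s c) (hWs0 c) (hWss c) m₀)
      simp only [Finsupp.coe_equivFunOnFinite_symm] at hv
      change (V' c).mulVec (⇑(m₀.mapDomain Fin.succ)) i = (dv c).mapDomain Fin.succ i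
      rw [hv]
      refine Fin.cases ?_ (fun i' => ?_) i
      · rw [mapDomain_succ_apply_zero, mapDomain_succ_apply_zero]
      · rw [mapDomain_succ_apply_succ, mapDomain_succ_apply_succ]
        simpa [Matrix.mulVec, dotProduct] using hmin i'
  · -- `η` is the generic point of the axis `V(x̄_j : j ∈ J)`
    rw [hη]
    congr 1
    ext z
    simp only [Set.mem_range, Set.mem_image, Finset.mem_coe, hmemJ]
    constructor
    · rintro ⟨i, rfl⟩
      exact ⟨i.succ, ⟨i, rfl⟩, rfl⟩
    · rintro ⟨_, ⟨i, rfl⟩, rfl⟩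
      exact ⟨i, rfl⟩

end Summit.ResolutionOfSingularities.ResolutionOfSingularities.Theorems.FInjectiveMacaulayfication.CNCylinder

end
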